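import Summits.Ventures.CertifiedManyBodySolver.Downfold.RouterWordScoreFePnictideTypings
import Summits.Ventures.CertifiedManyBodySolver.Downfold.RouterWordScoreSingletonTypings

/-!
# The two «EPH / straddle» pair typings of the v8 slate in closed form: EPHMIX «EPH ∣ UND:MIXED+EPH» and DWMIX
# «EPH+UND:STRUCT ∣ UND:MIXED+EPH» — and exactly where they differ (seat hubbard-downfold-score-2 gen 21; companion of
# `RouterWordScoreFePnictideTypings.lean` p730054 / `…Triple.lean` p730367, filed BEFORE the M376 ThIr₃ record of WAVE TH)

Venture CertifiedManyBodySolver, cell `pub/hubbard-downfold`; namespace `Summit.Ventures.CertifiedManyBodySolver.Downfold.RouterScore`.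
Everything here is PROVED (no `sorry`, standard axioms).

EPHMIX = `expected_router_words = ['EPH', 'UND:MIXED+EPH']` is the typing of the 5d / early-d intermetallic rows whose honest
at-risk print is the R3c r_man straddle (M376 ThIr₃ — D-0150 QUEUE row 140, run-6 g14 «v14thir» j339159, lead g35 R-yx (d);
M499 TlNi₂Se₂ ×3; the CaIr₂ / BaIr₂ drafts type «EPH» only). DWMIX = `['EPH+UND:STRUCT', 'UND:MIXED+EPH']` is the density-wave
variant offered (and declined, STRUCTPAIR kept) for M503 BaTi₂As₂O (cur-1 g55 OFFER #217, lead g32 R-xw; score-2 block31).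
PROVED, for EVERY print `p :: tl` over the router's head alphabet: `score_ephmix` / `score_dwmix` (closed forms); `ephmix_agree_iff`
(AGREE iff led by «EPH», or led by «UND:MIXED» with «EPH» riding); `dwmix_agree_iff` (the same, except that an «EPH»-led print needs
the «UND:STRUCT» rider); THE DIFFERENCE SET `score_dwmix_ne_ephmix_iff`: the two typings disagree on a print iff it is «EPH»-led
WITHOUT «UND:STRUCT» behind it — and then DWMIX reads PARTIAL where EPHMIX reads AGREE (`bare_eph_under_both`); everywhere else they
are the same verdict (`score_dwmix_eq_ephmix_of`). Hence DWMIX is the STRICTER typing (`ephmix_agree_of_dwmix_agree`). The block44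
pre-box table for M376 (R-yx (d) desk run ≡) and the block31 DWMIX table follow by `decide`.

WHAT THIS IS NOT: not physics, not a statement about ThIr₃ / TlNi₂Se₂ / BaTi₂As₂O, not a typing ruling (the words are the curators' and
the lead's letters) and not the scorer of record — the kernel form of what the §4.2 letter can and cannot tell apart on these typings.
-/

namespace Summit.Ventures.CertifiedManyBodySolver.Downfold

namespace RouterScore

open Head

/-! ## §1 The two typings -/

/-- EPHMIX «EPH ∣ UND:MIXED+EPH» (M376 ThIr₃, M499 TlNi₂Se₂, …). [folklore] -/
def ephmix : List (List Head) := [[eph], [undMixed, eph]]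

/-- DWMIX «EPH+UND:STRUCT ∣ UND:MIXED+EPH» (the declined M503 variant; score-2 block31). [folklore] -/
def dwmix : List (List Head) := [[eph, undStruct], [undMixed, eph]]

/-- neither typing expects a structural PRIMARY («UND:STRUCT» is a rider in DWMIX, never a head). [folklore] -/
theorem mix_expect_no_structural :
    expectsStructural Head.structural ephmix = false ∧ expectsStructural Head.structural dwmix = false := by decide

/-! ## §2 EPHMIX in closed form -/

/-- EPHMIX IN CLOSED FORM: structural head ⇒ abstain; led by «EPH», or by «UND:MIXED» WITH «EPH» riding ⇒ `AGREE`; otherwise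
`PARTIAL` iff a typed primary occurs in the print (the rider-less straddle; «EPH» or «UND:MIXED» behind an untyped head), else
`DISAGREE`. [folklore] -/
theorem score_ephmix (p : Head) (tl : List Head) :
    score (p :: tl) ephmix =
      (if p.structural then .ABSTAIN_structure
       else if p = eph ∨ (p = undMixed ∧ eph ∈ tl) then .AGREE
       else if p = undMixed ∨ eph ∈ tl ∨ undMixed ∈ tl then .PARTIAL else .DISAGREE) := by
  by_cases hs : p.structural = true
  · rw [if_pos hs]; exact outcome_structural_abstain _ (by decide) hs mix_expect_no_structural.1
  rw [if_neg hs]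
  have hs' : p.structural = false := by simpa using hs
  have hgate : (p.structural && !expectsStructural Head.structural ephmix) = false := by rw [hs']; rfl
  by_cases hp : p = eph ∨ (p = undMixed ∧ eph ∈ tl)
  · rw [if_pos hp]
    rcases hp with rfl | ⟨rfl, he⟩
    · rw [show score (eph :: tl) ephmix = outcome Head.structural (eph :: tl) ephmix from rfl]
      rw [outcome_alts_congr Head.structural (eph :: tl) (alts' := [[undMixed, eph]] ++ [eph :: []])
        (by intro a; simp only [ephmix, List.cons_append, List.nil_append, List.mem_cons, List.not_mem_nil, or_false]; tauto)]
      exact outcome_eq_agree_of_self_typed Head.structural _ rfl (fun t ht => absurd ht (by simp))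
    · have : ephmix = [[eph]] ++ [undMixed :: [eph]] := rfl
      rw [show score (undMixed :: tl) ephmix = outcome Head.structural (undMixed :: tl) ephmix from rfl, this]
      exact outcome_eq_agree_of_self_typed Head.structural _ rfl
        (fun t ht => by simp only [List.mem_singleton] at ht; subst ht; exact List.mem_cons_of_mem _ he)
  rw [if_neg hp]
  rw [not_or, not_and_or] at hp
  have hne0 : eph ≠ p := fun h => hp.1 h.symm
  have hnofull : ∀ a ∈ ephmix, fullMatch (p :: tl) a = false := by
    intro a ha
    simp only [ephmix, List.mem_cons, List.not_mem_nil, or_false] at ha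
    rcases ha with rfl | rfl
    · exact fullMatch_eq_false_of_head_ne hne0
    · rcases hp.2 with hh | he
      · exact fullMatch_eq_false_of_head_ne (fun h => hh h.symm)
      · exact fullMatch_eq_false_of_not_mem (List.mem_cons_of_mem _ List.mem_cons_self)
          (fun hm => by rcases List.mem_cons.1 hm with h | h; exacts [hne0 h, he h])
  by_cases hm : p = undMixed ∨ eph ∈ tl ∨ undMixed ∈ tl
  · rw [if_pos hm]
    refine outcome_eq_partial_of Head.structural (by decide) hgate hnofull ?_
    rcases hm with rfl | hm | hm
    · exact ⟨[undMixed, eph], by simp [ephmix], by rw [primaryEmitted_cons_eq]; simp⟩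
    · exact ⟨[eph], by simp [ephmix], by rw [primaryEmitted_cons_eq]; simp [hm]⟩
    · exact ⟨[undMixed, eph], by simp [ephmix], by rw [primaryEmitted_cons_eq]; simp [hm]⟩
  · rw [if_neg hm]
    rw [not_or, not_or] at hm
    refine outcome_eq_disagree_of_no_primary_emitted Head.structural (by decide) hgate ?_
    intro a ha
    simp only [ephmix, List.mem_cons, List.not_mem_nil, or_false] at ha
    rcases ha with rfl | rfl
    · rw [primaryEmitted_cons_eq]; simp [hm.2.1, hne0]
    · rw [primaryEmitted_cons_eq]; simp [hm.2.2, Ne.symm hm.1]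

/-- EPHMIX: `AGREE` iff led by «EPH», or led by «UND:MIXED» with «EPH» riding (both heads typed). [folklore] -/
theorem ephmix_agree_iff (p : Head) (tl : List Head) :
    score (p :: tl) ephmix = .AGREE ↔ p = eph ∨ (p = undMixed ∧ eph ∈ tl) := by
  rw [score_ephmix]
  by_cases hs : p.structural = true
  · rw [if_pos hs]; constructor
    · intro h; exact absurd h (by decide)
    · rintro (rfl | ⟨rfl, _⟩) <;> exact absurd hs (by decide)
  rw [if_neg hs]
  by_cases hp : p = eph ∨ (p = undMixed ∧ eph ∈ tl)
  · rw [if_pos hp]; exact ⟨fun _ => hp, fun _ => rfl⟩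
  rw [if_neg hp]
  by_cases hm : p = undMixed ∨ eph ∈ tl ∨ undMixed ∈ tl
  · rw [if_pos hm]; exact ⟨fun h => absurd h (by decide), fun h => absurd h hp⟩
  · rw [if_neg hm]; exact ⟨fun h => absurd h (by decide), fun h => absurd h hp⟩

/-- EPHMIX: the d-head (k-head) print with «EPH» riding is `PARTIAL` — the pre-named at-risk print of M376 (LINE FIRST) and the
M499 TlNi₂Se₂ print of record ×3. [folklore] -/
theorem ephmix_khead_partial (tl : List Head) : score (undMultiorb :: eph :: tl) ephmix = .PARTIAL := by
  rw [score_ephmix, if_neg (by decide), if_neg (by rintro (h | ⟨h, _⟩) <;> exact absurd h (by decide)),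
    if_pos (Or.inr (Or.inl List.mem_cons_self))]

/-- EPHMIX: the rider-less straddle «UND:MIXED(…)» is `PARTIAL`. [folklore] -/
theorem ephmix_riderless_straddle (tl : List Head) (he : eph ∉ tl) : score (undMixed :: tl) ephmix = .PARTIAL := by
  rw [score_ephmix, if_neg (by decide), if_neg (by rintro (h | ⟨_, h⟩); exact absurd h (by decide); exact he h),
    if_pos (Or.inl rfl)]

/-! ## §3 DWMIX in closed form -/

/-- DWMIX IN CLOSED FORM: structural head ⇒ abstain; led by «EPH» WITH «UND:STRUCT» riding, or by «UND:MIXED» WITH «EPH» riding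
⇒ `AGREE`; otherwise `PARTIAL` iff a typed primary occurs in the print (bare «EPH» — the typed word's rider missing; the rider-less
straddle; «EPH» or «UND:MIXED» behind an untyped head), else `DISAGREE`. [folklore] -/
theorem score_dwmix (p : Head) (tl : List Head) :
    score (p :: tl) dwmix =
      (if p.structural then .ABSTAIN_structure
       else if (p = eph ∧ undStruct ∈ tl) ∨ (p = undMixed ∧ eph ∈ tl) then .AGREE
       else if p = eph ∨ p = undMixed ∨ eph ∈ tl ∨ undMixed ∈ tl then .PARTIAL else .DISAGREE) := by
  by_cases hs : p.structural = true
  · rw [if_pos hs]; exact outcome_structural_abstain _ (by decide) hs mix_expect_no_structural.2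
  rw [if_neg hs]
  have hs' : p.structural = false := by simpa using hs
  have hgate : (p.structural && !expectsStructural Head.structural dwmix) = false := by rw [hs']; rfl
  by_cases hp : (p = eph ∧ undStruct ∈ tl) ∨ (p = undMixed ∧ eph ∈ tl)
  · rw [if_pos hp]
    rcases hp with ⟨rfl, hu⟩ | ⟨rfl, he⟩
    · rw [show score (eph :: tl) dwmix = outcome Head.structural (eph :: tl) dwmix from rfl]
      rw [outcome_alts_congr Head.structural (eph :: tl) (alts' := [[undMixed, eph]] ++ [eph :: [undStruct]])
        (by intro a; simp only [dwmix, List.cons_append, List.nil_append, List.mem_cons, List.not_mem_nil, or_false]; tauto)]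
      exact outcome_eq_agree_of_self_typed Head.structural _ rfl
        (fun t ht => by simp only [List.mem_singleton] at ht; subst ht; exact List.mem_cons_of_mem _ hu)
    · have : dwmix = [[eph, undStruct]] ++ [undMixed :: [eph]] := rfl
      rw [show score (undMixed :: tl) dwmix = outcome Head.structural (undMixed :: tl) dwmix from rfl, this]
      exact outcome_eq_agree_of_self_typed Head.structural _ rfl
        (fun t ht => by simp only [List.mem_singleton] at ht; subst ht; exact List.mem_cons_of_mem _ he)
  rw [if_neg hp]
  rw [not_or, not_and_or, not_and_or] at hp
  have hnofull : ∀ a ∈ dwmix, fullMatch (p :: tl) a = false := by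
    intro a ha
    simp only [dwmix, List.mem_cons, List.not_mem_nil, or_false] at ha
    rcases ha with rfl | rfl
    · by_cases hpe : p = eph
      · subst hpe
        rcases hp.1 with hh | hu
        · exact absurd rfl hh
        · exact fullMatch_eq_false_of_not_mem (List.mem_cons_of_mem _ List.mem_cons_self)
            (fun hm => by rcases List.mem_cons.1 hm with h | h; exacts [absurd h (by decide), hu h])
      · exact fullMatch_eq_false_of_head_ne (fun h => hpe h.symm)
    · by_cases hpm : p = undMixed
      · subst hpm
        rcases hp.2 with hh | he
        · exact absurd rfl hh
        · exact fullMatch_eq_false_of_not_mem (List.mem_cons_of_mem _ List.mem_cons_self)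
            (fun hm => by rcases List.mem_cons.1 hm with h | h; exacts [absurd h (by decide), he h])
      · exact fullMatch_eq_false_of_head_ne (fun h => hpm h.symm)
  by_cases hm : p = eph ∨ p = undMixed ∨ eph ∈ tl ∨ undMixed ∈ tl
  · rw [if_pos hm]
    refine outcome_eq_partial_of Head.structural (by decide) hgate hnofull ?_
    rcases hm with rfl | rfl | hm | hm
    · exact ⟨[eph, undStruct], by simp [dwmix], by rw [primaryEmitted_cons_eq]; simp⟩
    · exact ⟨[undMixed, eph], by simp [dwmix], by rw [primaryEmitted_cons_eq]; simp⟩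
    · exact ⟨[eph, undStruct], by simp [dwmix], by rw [primaryEmitted_cons_eq]; simp [hm]⟩
    · exact ⟨[undMixed, eph], by simp [dwmix], by rw [primaryEmitted_cons_eq]; simp [hm]⟩
  · rw [if_neg hm]
    rw [not_or, not_or, not_or] at hm
    refine outcome_eq_disagree_of_no_primary_emitted Head.structural (by decide) hgate ?_
    intro a ha
    simp only [dwmix, List.mem_cons, List.not_mem_nil, or_false] at ha
    rcases ha with rfl | rfl
    · rw [primaryEmitted_cons_eq]; simp [hm.2.2.1, Ne.symm hm.1]
    · rw [primaryEmitted_cons_eq]; simp [hm.2.2.2, Ne.symm hm.2.1]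

/-- DWMIX: `AGREE` iff led by «EPH» with «UND:STRUCT» riding, or led by «UND:MIXED» with «EPH» riding. [folklore] -/
theorem dwmix_agree_iff (p : Head) (tl : List Head) :
    score (p :: tl) dwmix = .AGREE ↔ (p = eph ∧ undStruct ∈ tl) ∨ (p = undMixed ∧ eph ∈ tl) := by
  rw [score_dwmix]
  by_cases hs : p.structural = true
  · rw [if_pos hs]; constructor
    · intro h; exact absurd h (by decide)
    · rintro (⟨rfl, _⟩ | ⟨rfl, _⟩) <;> exact absurd hs (by decide)
  rw [if_neg hs]
  by_cases hp : (p = eph ∧ undStruct ∈ tl) ∨ (p = undMixed ∧ eph ∈ tl)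
  · rw [if_pos hp]; exact ⟨fun _ => hp, fun _ => rfl⟩
  rw [if_neg hp]
  by_cases hm : p = eph ∨ p = undMixed ∨ eph ∈ tl ∨ undMixed ∈ tl
  · rw [if_pos hm]; exact ⟨fun h => absurd h (by decide), fun h => absurd h hp⟩
  · rw [if_neg hm]; exact ⟨fun h => absurd h (by decide), fun h => absurd h hp⟩

/-! ## §4 Exactly where the two typings differ -/

/-- THE BARE-«EPH» PRINT UNDER BOTH: without «UND:STRUCT» behind it, an «EPH»-led print is `PARTIAL` under DWMIX (the typed word's
rider missing — `outcome_single_alt` class) and `AGREE` under EPHMIX. [folklore] -/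
theorem bare_eph_under_both (tl : List Head) (hu : undStruct ∉ tl) :
    score (eph :: tl) dwmix = .PARTIAL ∧ score (eph :: tl) ephmix = .AGREE := by
  refine ⟨?_, ?_⟩
  · rw [score_dwmix, if_neg (by decide), if_neg (by rintro (⟨_, h⟩ | ⟨h, _⟩); exact hu h; exact absurd h (by decide)),
      if_pos (Or.inl rfl)]
  · rw [score_ephmix, if_neg (by decide), if_pos (Or.inl rfl)]

/-- Away from that print the two typings return THE SAME verdict. [folklore] -/
theorem score_dwmix_eq_ephmix_of (p : Head) (tl : List Head) (h : p ≠ eph ∨ undStruct ∈ tl) :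
    score (p :: tl) dwmix = score (p :: tl) ephmix := by
  rw [score_dwmix, score_ephmix]
  by_cases hs : p.structural = true
  · rw [if_pos hs, if_pos hs]
  rw [if_neg hs, if_neg hs]
  rcases h with hne | hu
  · -- not EPH-led: the AGREE conditions coincide, and so do the PARTIAL conditions
    have e1 : ((p = eph ∧ undStruct ∈ tl) ∨ (p = undMixed ∧ eph ∈ tl)) ↔ (p = eph ∨ (p = undMixed ∧ eph ∈ tl)) := by
      constructor
      · rintro (⟨h, _⟩ | h); exacts [absurd h hne, Or.inr h]
      · rintro (h | h); exacts [absurd h hne, Or.inr h]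
    have e2 : (p = eph ∨ p = undMixed ∨ eph ∈ tl ∨ undMixed ∈ tl) ↔ (p = undMixed ∨ eph ∈ tl ∨ undMixed ∈ tl) := by
      constructor
      · rintro (h | h); exacts [absurd h hne, h]
      · exact fun h => Or.inr h
    simp only [e1, e2]
  · by_cases hpe : p = eph
    · subst hpe
      rw [if_pos (Or.inl ⟨rfl, hu⟩), if_pos (Or.inl rfl)]
    · have e1 : ((p = eph ∧ undStruct ∈ tl) ∨ (p = undMixed ∧ eph ∈ tl)) ↔ (p = eph ∨ (p = undMixed ∧ eph ∈ tl)) := by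
        constructor
        · rintro (⟨h, _⟩ | h); exacts [absurd h hpe, Or.inr h]
        · rintro (h | h); exacts [absurd h hpe, Or.inr h]
      have e2 : (p = eph ∨ p = undMixed ∨ eph ∈ tl ∨ undMixed ∈ tl) ↔ (p = undMixed ∨ eph ∈ tl ∨ undMixed ∈ tl) := by
        constructor
        · rintro (h | h); exacts [absurd h hpe, h]
        · exact fun h => Or.inr h
      simp only [e1, e2]

/-- THE DIFFERENCE SET: DWMIX and EPHMIX disagree on a print iff it is «EPH»-led without «UND:STRUCT» behind it. [folklore] -/
theorem score_dwmix_ne_ephmix_iff (p : Head) (tl : List Head) :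
    score (p :: tl) dwmix ≠ score (p :: tl) ephmix ↔ p = eph ∧ undStruct ∉ tl := by
  constructor
  · intro hne
    by_contra hc
    rw [not_and_or, not_not] at hc
    rcases hc with h | h
    · exact hne (score_dwmix_eq_ephmix_of p tl (Or.inl h))
    · exact hne (score_dwmix_eq_ephmix_of p tl (Or.inr h))
  · rintro ⟨rfl, hu⟩
    have h := bare_eph_under_both tl hu
    rw [h.1, h.2]; decide

/-- Hence DWMIX is the STRICTER typing: whatever it reads AGREE, EPHMIX reads AGREE. [folklore] -/
theorem ephmix_agree_of_dwmix_agree (p : Head) (tl : List Head) (h : score (p :: tl) dwmix = .AGREE) :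
    score (p :: tl) ephmix = .AGREE := by
  rw [dwmix_agree_iff] at h
  rw [ephmix_agree_iff]
  rcases h with ⟨hp, _⟩ | h
  · exact Or.inl hp
  · exact Or.inr h

/-- … and the converse fails exactly on the bare «EPH» print. [folklore] -/
theorem dwmix_stricter_witness : score [eph] ephmix = .AGREE ∧ score [eph] dwmix = .PARTIAL := by decide

/-! ## §5 The registered tables by `decide` -/

/-- The block44 pre-box table for M376 ThIr₃ (WAVE TH row 140; lead g35 R-yx (d) desk run on router_score.py `0c928032ea6f3e9f` ≡):
«EPH», «EPH+SA», the R3c straddle «UND:MIXED(r_man …)+EPH», the MIXED-led composite with a k-head inside ⇒ AGREE; the rider-less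
straddle, the k-head «UND:MULTIORB(k=5; J_H)+EPH» (LINE FIRST, pre-named since g14), an «UND:HF-candidate+EPH» comparator ⇒ PARTIAL;
bare «UND:MULTIORB», «BI» ⇒ DISAGREE; a structure-led print ⇒ ABSTAIN(structure). [folklore] -/
theorem thir3_table :
    score [eph] ephmix = .AGREE ∧ score [eph, sa] ephmix = .AGREE ∧ score [undMixed, eph] ephmix = .AGREE ∧
    score [undMixed, undMultiorb, eph] ephmix = .AGREE ∧
    score [undMixed] ephmix = .PARTIAL ∧ score [undMultiorb, eph] ephmix = .PARTIAL ∧ score [undHF, eph] ephmix = .PARTIAL ∧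
    score [undMultiorb] ephmix = .DISAGREE ∧ score [bi] ephmix = .DISAGREE ∧
    score [undStruct, eph] ephmix = .ABSTAIN_structure := by
  decide

/-- M499 TlNi₂Se₂ @0 / @0.86 / @2.2 (WORDS rows 862 / 866 / 867): the k-head print with «EPH» riding ×3 against EPHMIX ⇒ PARTIAL ×3,
word-identical (no split; `RouterScoreHeaderReading.wordIdentical_not_split`). [folklore] -/
theorem tlni2se2_cells : score [undMultiorb, eph] ephmix = .PARTIAL := by decide

/-- The block31 DWMIX table (the declined M503 BaTi₂As₂O variant): «EPH+UND:STRUCT», the straddle «UND:MIXED+EPH(±UND:STRUCT)» ⇒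
AGREE; bare «EPH», «EPH+SA», the rider-less straddle, a Ti k-head with EPH or MIXED riding ⇒ PARTIAL; bare «UND:MULTIORB», «BI» ⇒
DISAGREE; structure-LED ⇒ ABSTAIN(structure). [folklore] -/
theorem dwmix_table :
    score [eph, undStruct] dwmix = .AGREE ∧ score [undMixed, eph] dwmix = .AGREE ∧ score [undMixed, eph, undStruct] dwmix = .AGREE ∧
    score [eph] dwmix = .PARTIAL ∧ score [eph, sa] dwmix = .PARTIAL ∧ score [undMixed] dwmix = .PARTIAL ∧
    score [undMultiorb, eph] dwmix = .PARTIAL ∧ score [undMultiorb, undMixed] dwmix = .PARTIAL ∧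
    score [undMultiorb] dwmix = .DISAGREE ∧ score [bi] dwmix = .DISAGREE ∧
    score [undStruct, eph] dwmix = .ABSTAIN_structure := by
  decide

/-- What the M503 typing choice would have decided on its print of record «UND:MIXED+EPH» (straddle, EPH riding): AGREE under DWMIX
(and under EPHMIX), PARTIAL under the STRUCTPAIR ≡ EPH-ONLY typing that was kept (`bati2pn2o_table`, p754634) — the pre-named
«straddle ⇒ PARTIAL» cell is a consequence of the typing kept, value-free. [folklore] -/
theorem m503_print_under_three_typings :
    score [undMixed, eph] dwmix = .AGREE ∧ score [undMixed, eph] ephmix = .AGREE ∧ score [undMixed, eph] ephOnly = .PARTIAL := by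
  decide

end RouterScore

end Summit.Ventures.CertifiedManyBodySolver.Downfold
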